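import Mathlib
import HarnessLib
import Summits.CriticalPhenomena.PercolationContinuityZ3.Theses.PercLowPointHalfSpace

/-!
# Crux-ideate sketch (round 1, ideator 2) for `TallClusterMassBound` (stmt-CriticalPhenomena-0912)

First lemmas of the two idea cards

* `replica-overlap-cs-transfer` : `UncondMassBound` (B′, drop the conditioning),
  `TruncatedSurfaceBubble` (TSB, replica overlap), and the PROVED reductions
  `uncondMassBound_implies_crux : UncondMassBound → TallClusterMassBound`,
  `tsb_implies_uncond : TruncatedSurfaceBubble → UncondMassBound`.
* `accessible-skeleton-overhang` : `AccessibleMassBound`, `OverhangMassBound`, the PROVED split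
  `skeleton_overhang_split : AccessibleMassBound → OverhangMassBound → TallClusterMassBound`,
  and the statement `AccessibleFromBoundaryRate` (accessible mass from a boundary one-arm rate).
* support candidates (statements only): `BulkArmLeSurfaceMass` (lowest-point bound),
  `BoundaryArmPolyLower` (π_s(r) ≥ c r⁻⁴).
-/

noncomputable section

namespace Summit.CriticalPhenomena.PercolationContinuityZ3.Cruxes.TallClusterMassBound.Ideas2

open MeasureTheory Finset
open Literature.Probability.LatticeModels Literature.Probability.Percolation
open Summit.CriticalPhenomena.PercolationContinuityZ3.Theses.PercLowPointHalfSpace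

/-- The critical bond-percolation measure on `ℤ³`. -/
abbrev μc : Measure (BondConfig (Site 3)) := bondPercolation (zdGraph 3) (criticalProbI 3)

/-- The closed upper half-space `ℍ = {x₀ ≥ 0}`. -/
abbrev HS : Set (Site 3) := {x : Site 3 | 0 ≤ x 0}

/-- `arm_ℍ(0,r)`: the half-space cluster of the wall point `0` reaches sup-distance `≥ r`
(verbatim the event used in the route decl `TallClusterMassBound`). -/
abbrev tall (r : ℕ) : Set (BondConfig (Site 3)) :=
  {ω | ∃ y : Site 3, (∃ i : Fin 3, (r : ℤ) ≤ |y i|) ∧ ω ∈ openConnIn HS 0 y}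

/-- `{0 ↔_ℍ x}`. -/
abbrev conn (x : Site 3) : Set (BondConfig (Site 3)) := openConnIn HS 0 x

/-! ### Card `replica-overlap-cs-transfer` -/

/-- **B′ (unconditional truncated surface susceptibility bound).**
`S_r := Σ_{x ∈ B_r} P(0 ↔_ℍ x) ≤ C r^{11/4} P(arm_ℍ(0,r))`. Implies the crux by `E[M;T] ≤ E[M]`. -/
def UncondMassBound : Prop :=
  ∃ C : ℝ, ∀ r : ℕ, 1 ≤ r →
    ∑ x ∈ box 3 r, μc.real (conn x) ≤ C * (r : ℝ) ^ ((11 : ℝ) / 4) * μc.real (tall r)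

/-- **TSB (truncated surface bubble = replica overlap).**
`Σ_{x ∈ B_r} P(0 ↔_ℍ x)² = E|U ∩ U' ∩ B_r| ≤ C r^{5/2} P(arm_ℍ(0,r))²` for two independent copies
`U, U'` of the half-space cluster of `0`. Cauchy–Schwarz turns it into B′ with no exponent loss. -/
def TruncatedSurfaceBubble : Prop :=
  ∃ C : ℝ, ∀ r : ℕ, 1 ≤ r →
    ∑ x ∈ box 3 r, (μc.real (conn x)) ^ 2 ≤ C * (r : ℝ) ^ ((5 : ℝ) / 2) * (μc.real (tall r)) ^ 2

/-- B′ ⟹ the crux (drop the conditioning: `P(A ∩ T) ≤ P(A)` termwise). -/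
theorem uncondMassBound_implies_crux : UncondMassBound → TallClusterMassBound := by
  rintro ⟨C, hC⟩
  refine ⟨C, fun r hr => ?_⟩
  refine le_trans (Finset.sum_le_sum fun x _ => ?_) (hC r hr)
  exact measureReal_mono Set.inter_subset_left

/-- TSB ⟹ B′ by Cauchy–Schwarz over the `(2r+1)³ ≤ 27 r³` points of the box. -/
theorem tsb_implies_uncond : TruncatedSurfaceBubble → UncondMassBound := by
  rintro ⟨C, hC⟩
  refine ⟨Real.sqrt (27 * max C 0), fun r hr => ?_⟩
  have hr0 : (0 : ℝ) < r := by exact_mod_cast hr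
  set P : ℝ := μc.real (tall r) with hP
  set A : ℝ := ∑ x ∈ box 3 r, μc.real (conn x) with hA
  have hA0 : 0 ≤ A := Finset.sum_nonneg fun x _ => measureReal_nonneg
  have hP0 : 0 ≤ P := measureReal_nonneg
  -- Cauchy–Schwarz with the constant function 1
  have hCS : A ^ 2 ≤ (∑ x ∈ box 3 r, (μc.real (conn x)) ^ 2) * (#(box 3 r) : ℝ) := by
    have h := Finset.sum_mul_sq_le_sq_mul_sq (box 3 r) (fun x => μc.real (conn x)) (fun _ => (1 : ℝ))
    simpa [hA] using h
  have hcard : (#(box 3 r) : ℝ) ≤ 27 * (r : ℝ) ^ 3 := by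
    rw [card_box]
    push_cast
    have h1 : (1 : ℝ) ≤ r := by exact_mod_cast hr
    nlinarith [h1, sq_nonneg ((r : ℝ) - 1), mul_pos hr0 hr0]
  have hmax : 0 ≤ max C 0 := le_max_right _ _
  have hsum : ∑ x ∈ box 3 r, (μc.real (conn x)) ^ 2 ≤ max C 0 * (r : ℝ) ^ ((5 : ℝ) / 2) * P ^ 2 := by
    refine le_trans (hC r hr) ?_
    have : C ≤ max C 0 := le_max_left _ _
    have hnn : 0 ≤ (r : ℝ) ^ ((5 : ℝ) / 2) * P ^ 2 := by positivity
    nlinarith [mul_le_mul_of_nonneg_right this hnn]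
  have h3 : (r : ℝ) ^ (3 : ℝ) = (r : ℝ) ^ 3 := by
    rw [show (3 : ℝ) = ((3 : ℕ) : ℝ) by norm_num, Real.rpow_natCast]
  have hpow : ((r : ℝ) ^ ((11 : ℝ) / 4)) ^ 2 = (r : ℝ) ^ ((5 : ℝ) / 2) * (r : ℝ) ^ 3 := by
    rw [← h3, ← Real.rpow_add hr0, ← Real.rpow_natCast, ← Real.rpow_mul hr0.le]
    congr 1
    push_cast
    norm_num
  have hsq : (Real.sqrt (27 * max C 0)) ^ 2 = 27 * max C 0 := Real.sq_sqrt (by positivity)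
  have hB : A ^ 2 ≤ (Real.sqrt (27 * max C 0) * (r : ℝ) ^ ((11 : ℝ) / 4) * P) ^ 2 := by
    calc A ^ 2 ≤ (∑ x ∈ box 3 r, (μc.real (conn x)) ^ 2) * (#(box 3 r) : ℝ) := hCS
      _ ≤ (max C 0 * (r : ℝ) ^ ((5 : ℝ) / 2) * P ^ 2) * (27 * (r : ℝ) ^ 3) :=
          mul_le_mul hsum hcard (by positivity) (mul_nonneg (mul_nonneg hmax (by positivity)) (sq_nonneg _))
      _ = (Real.sqrt (27 * max C 0) * (r : ℝ) ^ ((11 : ℝ) / 4) * P) ^ 2 := by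
          rw [mul_pow, mul_pow, hsq, hpow]; ring
  have hBnonneg : 0 ≤ Real.sqrt (27 * max C 0) * (r : ℝ) ^ ((11 : ℝ) / 4) * P := by positivity
  exact (pow_le_pow_iff_left₀ hA0 hBnonneg (by norm_num : (2 : ℕ) ≠ 0)).1 hB

/-- Hence TSB ⟹ the crux. -/
theorem tsb_implies_crux : TruncatedSurfaceBubble → TallClusterMassBound :=
  fun h => uncondMassBound_implies_crux (tsb_implies_uncond h)

/-! ### Card `accessible-skeleton-overhang` -/

/-- The slab `{0 ≤ y₀ ≤ h}`. -/
abbrev slabTo (h : ℤ) : Set (Site 3) := {y : Site 3 | 0 ≤ y 0 ∧ y 0 ≤ h}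

/-- `x` is *monotone-accessible*: `0 ↔ x` inside the slab `{0 ≤ y₀ ≤ x₀}` (the minimax height of
`x` in the half-space cluster equals its own height; `x` is a top-layer point `D_{x₀}` of the
slab-`x₀` cluster of `0`). -/
abbrev acc (x : Site 3) : Set (BondConfig (Site 3)) := openConnIn (slabTo (x 0)) 0 x

/-- **Accessible (skeleton) mass bound**: the tall cluster's accessible points in `B_r` are few. -/
def AccessibleMassBound : Prop :=
  ∃ C : ℝ, ∀ r : ℕ, 1 ≤ r →
    ∑ x ∈ box 3 r, μc.real (acc x ∩ tall r) ≤ C * (r : ℝ) ^ ((11 : ℝ) / 4) * μc.real (tall r)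

/-- **Overhang mass bound**: points of the tall cluster reached only through excursions above
their own level (the hanging blobs) number at most `C r^{11/4}` on average. -/
def OverhangMassBound : Prop :=
  ∃ C : ℝ, ∀ r : ℕ, 1 ≤ r →
    ∑ x ∈ box 3 r, μc.real ((conn x \ acc x) ∩ tall r) ≤ C * (r : ℝ) ^ ((11 : ℝ) / 4) * μc.real (tall r)

/-- Skeleton + overhang ⟹ the crux (union bound, constants add). -/
theorem skeleton_overhang_split :
    AccessibleMassBound → OverhangMassBound → TallClusterMassBound := by
  rintro ⟨C₁, h₁⟩ ⟨C₂, h₂⟩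
  refine ⟨C₁ + C₂, fun r hr => ?_⟩
  have key : ∀ x ∈ box 3 r, μc.real (conn x ∩ tall r) ≤
      μc.real (acc x ∩ tall r) + μc.real ((conn x \ acc x) ∩ tall r) := by
    intro x _
    refine le_trans (measureReal_mono ?_) (measureReal_union_le _ _)
    intro ω hω
    by_cases h : ω ∈ acc x
    · exact Or.inl ⟨h, hω.2⟩
    · exact Or.inr ⟨⟨hω.1, h⟩, hω.2⟩
  calc ∑ x ∈ box 3 r, μc.real (conn x ∩ tall r)
      ≤ ∑ x ∈ box 3 r, (μc.real (acc x ∩ tall r) + μc.real ((conn x \ acc x) ∩ tall r)) :=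
        Finset.sum_le_sum key
    _ = ∑ x ∈ box 3 r, μc.real (acc x ∩ tall r) + ∑ x ∈ box 3 r, μc.real ((conn x \ acc x) ∩ tall r) :=
        Finset.sum_add_distrib
    _ ≤ C₁ * (r : ℝ) ^ ((11 : ℝ) / 4) * μc.real (tall r) + C₂ * (r : ℝ) ^ ((11 : ℝ) / 4) * μc.real (tall r) :=
        add_le_add (h₁ r hr) (h₂ r hr)
    _ = (C₁ + C₂) * (r : ℝ) ^ ((11 : ℝ) / 4) * μc.real (tall r) := by ring

/-- **Accessible mass from a boundary one-arm RATE** (first lemma of the skeleton card; to be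
proved from the independent wall/ceiling split `P(0 ↔_{slab x₀} x) ≤ π_s(|x|/3)²` — both factors are
WALL-rooted arms, the ceiling one by the top–bottom reflection symmetry of the slab): a rate
`π_s(r) ≤ C₀ r^{-a}` gives unconditional accessible mass `≤ C r^{3-2a}`. -/
def AccessibleFromBoundaryRate : Prop :=
  ∀ a C₀ : ℝ, 0 < a → a < 1 →
    (∀ r : ℕ, 1 ≤ r → μc.real (tall r) ≤ C₀ * (r : ℝ) ^ (-a)) →
    ∃ C : ℝ, ∀ r : ℕ, 1 ≤ r →
      ∑ x ∈ box 3 r, μc.real (acc x) ≤ C * (r : ℝ) ^ (3 - 2 * a)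

/-! ### Support candidates (provable now; statements only here) -/

/-- **Lowest-point bound**: the bulk one-arm probability is at most the expected mass (within
`B_r`) of the wall cluster on the event that it reaches distance `⌈r/2⌉` — the inequality form of the
route's low-point identity (union over the lowest vertex of a witnessing path). -/
def BulkArmLeSurfaceMass : Prop :=
  ∀ r : ℕ, 1 ≤ r →
    μc.real (siteToBoundary 3 r) ≤ ∑ x ∈ box 3 r, μc.real (conn x ∩ tall ((r + 1) / 2))

/-- **Polynomial lower bound for the boundary one-arm**: `π_s(r) ≥ c r^{-4}` (from
`BulkArmLeSurfaceMass`, `|B_r| ≤ 27 r³` and the bulk bound `π(r) ≥ c/r` that follows from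
`φ_{p_c}(Λ_r) ≥ 1` and `τ ≤ π(r/3)²`). -/
def BoundaryArmPolyLower : Prop :=
  ∃ c : ℝ, 0 < c ∧ ∀ r : ℕ, 1 ≤ r → c * (r : ℝ) ^ (-(4 : ℝ)) ≤ μc.real (tall r)

end Summit.CriticalPhenomena.PercolationContinuityZ3.Cruxes.TallClusterMassBound.Ideas2
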